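import Literature.NumberTheory.Sieve.IwaniecAlmostPrimesProp2LowerGeneral
import Literature.NumberTheory.Sieve.IwaniecAlmostPrimesCardP2
import Literature.NumberTheory.Sieve.IwaniecAlmostPrimesLemma2
import Literature.NumberTheory.Sieve.IwaniecAlmostPrimesProp1
import HarnessLib

/-!
# Iwaniec (1978): display (2) at `z = x^{1/5}` DISCHARGED — `weightedSum_lower_holds` (and the other §§2, 5 named facts for `n² + 1`)

H. Iwaniec, *Almost-primes represented by quadratic polynomials*, Invent. Math. **47** (1978)
171–188 [cite: IwaniecInventiones1978, Theorem p. 172 (1), §2 (2) p. 173, Corollary p. 176,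
Proposition 2 p. 185, §6 p. 187].

Sibling proof file (theorems only, no new definitions) of `IwaniecAlmostPrimes.lean`.  The tree
already contains the whole printed proof of the paper for `G(n) = n² + 1`, conditional on its two
named inputs, and — since `IwaniecAlmostPrimesLemma2.lean` and `IwaniecAlmostPrimesProp1.lean` —
both inputs PROVED:

* `Iwaniec1978.lemma2_bilinearSieve_holds` (`IwaniecAlmostPrimesLemma2.lean`) — Lemma 2, the
  linear sieve with the bilinear form of the remainder term (= Iwaniec, Acta Arith. **37** (1980),
  Theorem 1);
* `Iwaniec1978.proposition1_holds` (`IwaniecAlmostPrimesProp1.lean`) — Proposition 1 (p. 176),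
  the dispersion estimate, from Lemmas 4–7 (Lemma 6 = Hooley's bound for incomplete Kloosterman
  sums, resting on Weil's bound, `KloostermanWeilPrimeProofs`).

This file only joins those two leaves to the proved glue theorems, which live in modules none of
which imports the two leaf modules:

* `weightedSum_lower_holds` — display (2), p. 173, at the final choice `z = x^{1/5}` (p. 187):
  `W(𝒜, x^{1/5}) > (Γ/77) x / log x` for all large `x`, by
  `weightedSum_lower_of_lemma2_of_proposition1` (`IwaniecAlmostPrimesProp2Lower.lean`: both
  halves of Proposition 2, the §6 evaluation of `IwaniecAlmostPrimesWeightedSum.lean` and the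
  numerical inequality `IsLinearSieveFunctions.numerics` of `IwaniecAlmostPrimesNumerics.lean`);
* `proposition1_corollary_holds` — the Corollary of Proposition 1 (p. 176, level `x^{16/15}` in
  bilinear form), by `proposition1_corollary_of` (`IwaniecAlmostPrimesProp1Corollary.lean`);
* `proposition2_upper_holds`, `proposition2_lower_holds`, `proposition2_lower_const_holds` —
  Proposition 2 (p. 185), by `proposition2_upper_of_lemma2_of_proposition1`
  (`IwaniecAlmostPrimesProp2Lower.lean`), `proposition2_lower_of_lemma2_of_proposition1`
  (`IwaniecAlmostPrimesProp2LowerGeneral.lean`) and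
  `proposition2_lower_const_of_lemma2_of_proposition1` (`IwaniecAlmostPrimesProp2Lower.lean`);
* `card_P2_lower_holds` — display (1) of the Theorem for `n² + 1` (p. 172):
  `#{1 ≤ n ≤ x : Ω(n² + 1) ≤ 2} > (Γ/77) x / log x` for all large `x`, by
  `card_P2_lower_of_lemma2_of_proposition1` (`IwaniecAlmostPrimesCardP2.lean`).

(The qualitative Theorem 1, parity.S19, is discharged in `ParityWave0IwaniecHolds.lean`.)
All axioms standard; after this file the only named fact of `IwaniecAlmostPrimes.lean` left
unproved is `theorem_quadratic` (the Theorem for a general irreducible quadratic `G`).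

## References

* H. Iwaniec, *Almost-primes represented by quadratic polynomials*, Invent. Math. 47 (1978),
  171–188, doi:10.1007/BF01578070. [IwaniecInventiones1978]
* H. Iwaniec, *A new form of the error term in the linear sieve*, Acta Arith. 37 (1980), 307–320,
  Theorem 1. [IwaniecActaArith1980b]
-/

noncomputable section

namespace Literature.NumberTheory.Sieve.Iwaniec1978

/-- **Iwaniec 1978, display (2) (p. 173) with `z = x^{1/5}` (p. 187) — PROVED:** for all
sufficiently large `x`, `W(𝒜, x^{1/5}) > (1/77) Γ x / log x`, where `W(𝒜, z)` is Richert's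
weighted sum at `λ = 2` over `{n ≤ x : (n² + 1, P(z)) = 1}` (`weightedSum`).  Lemma 2
(`lemma2_bilinearSieve_holds`) and Proposition 1 (`proposition1_holds`) fed into the proved
assembly `weightedSum_lower_of_lemma2_of_proposition1` (Proposition 2, §6 and the numerics
`e^γ/770 < f(16/3) − T₃ − T₄ − T₅`). [cite: IwaniecInventiones1978, §2 (2) p. 173 and §6 p. 187] -/
theorem weightedSum_lower_holds : weightedSum_lower :=
  weightedSum_lower_of_lemma2_of_proposition1 lemma2_bilinearSieve_holds proposition1_holds

/-- **Iwaniec 1978, Corollary of Proposition 1 (p. 176) — PROVED:** level of distribution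
`x^{16/15}` for `n² + 1` in bilinear form, from Proposition 1 (`proposition1_holds`) by the proved
deduction `proposition1_corollary_of`. [cite: IwaniecInventiones1978, Corollary p. 176] -/
theorem proposition1_corollary_holds : proposition1_corollary :=
  proposition1_corollary_of proposition1_holds

/-- **Iwaniec 1978, Proposition 2 (p. 185), upper bound — PROVED** from Lemma 2 and
Proposition 1 (`proposition2_upper_of_lemma2_of_proposition1`).
[cite: IwaniecInventiones1978, Proposition 2 p. 185] -/
theorem proposition2_upper_holds : proposition2_upper :=
  proposition2_upper_of_lemma2_of_proposition1 lemma2_bilinearSieve_holds proposition1_holds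

/-- **Iwaniec 1978, Proposition 2 (p. 185), lower bound (variable levels `z ≤ z_q < x^{1/2}`) —
PROVED** from Lemma 2 and Proposition 1 (`proposition2_lower_of_lemma2_of_proposition1`,
`IwaniecAlmostPrimesProp2LowerGeneral.lean`). [cite: IwaniecInventiones1978, Proposition 2 p. 185] -/
theorem proposition2_lower_holds : proposition2_lower :=
  proposition2_lower_of_lemma2_of_proposition1 lemma2_bilinearSieve_holds proposition1_holds

/-- **Iwaniec 1978, Proposition 2 (p. 185), lower bound at a constant level — PROVED** (the
specialisation `proposition2_lower.const` of the general lower bound).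
[cite: IwaniecInventiones1978, Proposition 2 p. 185] -/
theorem proposition2_lower_const_holds : proposition2_lower_const :=
  proposition2_lower_holds.const

/-- **Iwaniec 1978, display (1) of the Theorem for `G = n² + 1` (p. 172) — PROVED:** for all
sufficiently large `x`, `#{1 ≤ n ≤ x : Ω(n² + 1) ≤ 2} > (1/77) Γ x / log x`, from Lemma 2 and
Proposition 1 by the proved assembly `card_P2_lower_of_lemma2_of_proposition1`
(`IwaniecAlmostPrimesCardP2.lean`: (2) with its §6 slack kept, Lemma 1 and the bound
`O(x z^{-1/2})` for the non-squarefree elements of `𝒜`, p. 173).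
[cite: IwaniecInventiones1978, Theorem p. 172 (1)] -/
theorem card_P2_lower_holds : card_P2_lower :=
  card_P2_lower_of_lemma2_of_proposition1 lemma2_bilinearSieve_holds proposition1_holds

end Literature.NumberTheory.Sieve.Iwaniec1978

end
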